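import Summits.CriticalPhenomena.CardyFormulaZ2.Theorems.CardySusyWardParafermionFamiliesToSLESixAnchoredWallFluxPhase
import Summits.CriticalPhenomena.CardyFormulaZ2.Theorems.CardySusyWardParafermionFamiliesToSLESixAnchoredWallFluxDarts

/-!
# The concrete anchor family (skeleton r4 of line `strip-anchored-vertex-normalisation`,
# crux stmt-CriticalPhenomena-10814), V: WIRED touches — the winding of the exploration at a dart
# whose vertex is on the wired arc does not depend on the configuration

Generic helper file (registered one-line form `stub_anchor_wiredPhase`) for the three wired-side phase
packages `stub_anchorWiredPhaseLR/UL/LL` of the stub `stub_anchorMoment_of_IP`: the wired-arc mirror of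
S5's TouchModulus / TouchPhase files (`…AnchoredWallFluxTouch.lean`, `…AnchoredWallFluxPhase.lean`), with
CLOSING edges in place of opening them. Admissible data `E` with hole-free inner faces, completed
configurations `β = E.bcBondConfig ω`, cut orbits `orb` of the start corner `c₀`, exit times `T`.

* `wnd_fcell_cross` — across a CLOSED edge the winding number of a cycle of the turning rule is the same on
  the two face cells (the dual form of `S5.wnd_vcell_eq_of_mem`: if the crossing corner is on the cycle so
  is its successor and both jump by one from the common vertex cell; otherwise the tube lemma).
* `wnd_fcell_orbit` — hence the face cells along a stretch of the cut orbit of a LARGER configuration all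
  carry the same winding number (following keeps the face, crossing crosses an edge closed in both).
* `visit_anti` — **a dart `c` with vertex on the arc `A` visited by the `ω`-exploration is visited by the
  `ω'`-exploration for every `ω' ⊆ ω`**: otherwise the `ω'`-orbit of `c` is a cycle of inner corners off the
  path (`S5.isInnerFace_iterate`), its winding number jumps by one from the vertex cell of `c` (zero: a
  boundary site, `S5.wnd_vcell_eq_zero_of_isCorner`) to the face cell of `c`, which by `wnd_fcell_orbit`
  along the `ω`-path from `c` to its exit is the winding number of the non-inner exit face, zero.
* `visit_chain`, `turnCount_visit` — **wired TouchPhase**: closing finitely many edges one at a time keeps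
  the visit and its turn count (`S5.turnCount_eq_of_agree_off`); two configurations visiting `c` are so
  reduced to two with the same completed configuration, so the turn count at `c` is configuration-independent.
* `orbit_pred_of_mem` — the predecessor of a dart through an OPEN source edge is the follow-predecessor.
* `cornerObs_eq_of_visit_iff` — evaluation: if a coded corner `r` is visited iff the reference corner
  `(w, 0)` is, and its turn count is the constant `τ`, then `cornerObs = sixthPhase τ · P(visit)`.
-/

noncomputable section

namespace Summit.CriticalPhenomena.CardyFormulaZ2.Theorems.ParafermionFamiliesToSLESix.StripAnchored

open MeasureTheory Function
open Literature.Probability.Percolation (bondPercolation half BondConfig vcell fcell cornerDart lf_cornerDart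
  rf_cornerDart orbitTrail isTrail_orbitTrail mem_cdarts_orbitTrail_iff wnd_vcell_sub_wnd_fcell
  orbitTrail_eq_cornerOrbit cornerOrbit_ne_of_lt_minimalPeriod)
open Literature.Probability.LatticeModels
open Literature.Probability.LatticeModels.DiscreteDobrushin (startCorner exitTime isStartCorner_startCorner
  isInnerFace_of_lt_exitTime not_isInnerFace_exitTime)
open Literature.Probability.LatticeModels.MedialTrail (wnd cdarts)
open Summit.CriticalPhenomena.CardyFormulaZ2.Cruxes.EdgePrecompact.QkzStripBoundaryArm (cornerObs)
open S2 (sixthPhase dartW dartW_eq_single dartW_eq_zero)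

namespace WiredTouch

variable {E : DiscreteDobrushin} {ω ω' : BondConfig (Site 2)}

/-! ## Winding numbers of face cells across closed edges -/

/-- **Across a closed edge the two face cells carry the same winding number** of a cycle of the turning
rule: for the corner `q` arriving at the closed edge `cTgt q` and its cross-successor `(q.1, q.2 + 1)`,
either both darts are on the cycle (and both jump by one from the common vertex cell) or neither is
(tube lemma). [folklore] -/
theorem wnd_fcell_cross {β : BondConfig (Site 2)} {c : Site 2 × Fin 4} (hp : c ∈ periodicPts (nextCorner β))
    {q : Site 2 × Fin 4} (hq : cTgt q ∉ β) :
    wnd (orbitTrail β c) (fcell (cFace (q.1, q.2 + 1))) = wnd (orbitTrail β c) (fcell (cFace q)) := by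
  have hT := isTrail_orbitTrail hp
  have hnext : nextCorner β q = (q.1, q.2 + 1) := nextCorner_of_not_mem hq
  rw [← rf_cornerDart, ← rf_cornerDart]
  by_cases hmem : cornerDart q ∈ cdarts (orbitTrail β c)
  · have hmem' : cornerDart (q.1, q.2 + 1) ∈ cdarts (orbitTrail β c) := by
      rw [← hnext]; exact (S5.mem_cdarts_nextCorner_iff hp q).2 hmem
    have h1 := hT.wnd_lf hmem
    have h2 := hT.wnd_lf hmem'
    rw [lf_cornerDart] at h1 h2
    simp only at h2
    omega
  · have hmem' : cornerDart (q.1, q.2 + 1) ∉ cdarts (orbitTrail β c) := fun h =>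
      hmem ((S5.mem_cdarts_nextCorner_iff hp q).1 (by rw [hnext]; exact h))
    obtain ⟨-, -, h3⟩ := S2.tube_cornerDart hT.2.2 (S2.cornerDart_snd_eq q) hmem hmem'
    exact h3

/-- **Face cells along a stretch of a cut orbit of a larger configuration carry one winding number**:
for `β' ⊆ β`, a `β'`-cycle `c` and the `β`-orbit of `c₀`, the cells of the faces of `orb n` and `orb (n + m)`
have the same winding number (following an open edge keeps the face; a crossed edge is closed in `β`, hence
in `β'`, and `wnd_fcell_cross` applies). [folklore] -/
theorem wnd_fcell_orbit {β β' : BondConfig (Site 2)} {c : Site 2 × Fin 4} (hp : c ∈ periodicPts (nextCorner β'))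
    (hsub : β' ⊆ β) (c₀ : Site 2 × Fin 4) (n : ℕ) : ∀ m,
    wnd (orbitTrail β' c) (fcell (cFace (cornerOrbit β c₀ (n + m)))) =
      wnd (orbitTrail β' c) (fcell (cFace (cornerOrbit β c₀ n))) := by
  intro m
  induction m with
  | zero => rfl
  | succ m ih =>
    rw [← ih, ← add_assoc]
    change wnd (orbitTrail β' c) (fcell (cFace (nextCorner β (cornerOrbit β c₀ (n + m))))) = _
    by_cases h : cTgt (cornerOrbit β c₀ (n + m)) ∈ β
    · rw [cFace_nextCorner_of_mem h]
    · rw [nextCorner_of_not_mem h]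
      exact wnd_fcell_cross hp fun h' => h (hsub h')

/-! ## Visits of darts with vertex on the wired arc persist when edges are closed -/

section Visit

variable (hE : E.IsZdAdmissible)

/-- **A dart with vertex on the arc `A` visited by the `ω`-exploration is visited by the `ω'`-exploration
for every `ω' ⊆ ω`** (before its exit time). [cite: DuminilCopin2012Parafermion, Proposition 5] -/
theorem visit_anti (hH : HoleFree {f : Site 2 | E.IsInnerFace f}) {c : Site 2 × Fin 4} (hA : c.1 ∈ E.zdArcA)
    (hle : ω' ⊆ ω) {n : ℕ} (hn : n < exitTime hE ω) (hcn : cornerOrbit (E.bcBondConfig ω) (startCorner hE) n = c) :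
    ∃ m < exitTime hE ω', cornerOrbit (E.bcBondConfig ω') (startCorner hE) m = c := by
  by_contra hoff
  push Not at hoff
  have hc : E.IsInnerFace (cFace c) := hcn ▸ isInnerFace_of_lt_exitTime hE ω hn
  have hnB : c.1 ∉ E.zdArcB := fun hB => Set.disjoint_left.1 hE.disjoint hA hB
  have hp := S5.mem_periodicPts_of_off hE hc hnB hoff
  have hLin := S5.isInnerFace_iterate hE hc hnB hoff
  set l := orbitTrail (E.bcBondConfig ω') c
  have h1 : wnd l (vcell c.1) - wnd l (fcell (cFace c)) = 1 := by
    have := wnd_vcell_sub_wnd_fcell hp c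
    rwa [if_pos ⟨0, rfl⟩] at this
  have h2 : wnd l (vcell c.1) = 0 := by
    obtain ⟨g, hag, hg⟩ := S5.exists_not_isInnerFace_of_mem_zdBoundary (E.zdArcA_subset_zdBoundary hA)
    exact S5.wnd_vcell_eq_zero_of_isCorner hH hp hLin hag hg
  have h3 : wnd l (fcell (cFace c)) = 0 := by
    have key := wnd_fcell_orbit hp (E.bcBondConfig_mono hle) (startCorner hE) n (exitTime hE ω - n)
    rw [show n + (exitTime hE ω - n) = exitTime hE ω by omega, hcn] at key
    rw [← key, orbitTrail_eq_cornerOrbit]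
    exact S2.wnd_fcell_eq_zero_of_not_isInnerFace hH (minimalPeriod_pos_of_mem_periodicPts hp)
      (by rw [cornerOrbit_eq_iterate]; exact iterate_minimalPeriod) (cornerOrbit_ne_of_lt_minimalPeriod hp)
      (fun m => by rw [cornerOrbit_eq_iterate]; exact hLin m) (not_isInnerFace_exitTime hE ω)
  omega

/-- **Closing finitely many edges keeps the visit and its turn count**: for a finite set `s` of edges,
the `(ω \ s)`-exploration visits `c` (vertex on `A`) at some dart with the same turn count as the
`ω`-exploration at its dart `orb n = c`. [cite: Smirnov2010, proof of Lemma 4.5] -/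
theorem visit_chain (hH : HoleFree {f : Site 2 | E.IsInnerFace f}) {c : Site 2 × Fin 4} (hA : c.1 ∈ E.zdArcA)
    {n : ℕ} (hn : n < exitTime hE ω) (hcn : cornerOrbit (E.bcBondConfig ω) (startCorner hE) n = c)
    {s : Set (Sym2 (Site 2))} (hs : s.Finite) :
    ∃ m < exitTime hE (ω \ s), cornerOrbit (E.bcBondConfig (ω \ s)) (startCorner hE) m = c ∧
      turnCount (E.bcBondConfig (ω \ s)) (startCorner hE) m = turnCount (E.bcBondConfig ω) (startCorner hE) n := by
  induction s, hs using Set.Finite.induction_on with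
  | empty => rw [Set.sdiff_empty]; exact ⟨n, hn, hcn, rfl⟩
  | @insert a s _ _ ih =>
    obtain ⟨m, hm, hcm, htc⟩ := ih
    have hsub : ω \ insert a s ⊆ ω \ s := Set.sdiff_subset_sdiff_right (Set.subset_insert a s)
    obtain ⟨m', hm', hcm'⟩ := visit_anti hE hH hA hsub hm hcm
    refine ⟨m', hm', hcm', ?_⟩
    rw [← htc]
    refine (S5.turnCount_eq_of_agree_off hE hH (e := a) (fun e' he' => ?_) hm hm' hcm hcm').symm
    simp only [DiscreteDobrushin.mem_bcBondConfig_iff, Set.mem_sdiff, Set.mem_insert_iff, not_or]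
    tauto

/-- **Wired TouchPhase.** For two configurations whose explorations visit the dart `c` (vertex on the arc
`A`) at `orb n = c = orb' n'`, the turn counts (windings in quarter turns) there agree: closing the finitely
many edges of `Ω_δ` open in only one of them leads to two configurations with the same completed
configuration. [cite: Smirnov2010, proof of Lemma 4.5] -/
theorem turnCount_visit (hH : HoleFree {f : Site 2 | E.IsInnerFace f}) {c : Site 2 × Fin 4} (hA : c.1 ∈ E.zdArcA)
    {n n' : ℕ} (hn : n < exitTime hE ω) (hn' : n' < exitTime hE ω')
    (hcn : cornerOrbit (E.bcBondConfig ω) (startCorner hE) n = c)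
    (hcn' : cornerOrbit (E.bcBondConfig ω') (startCorner hE) n' = c) :
    turnCount (E.bcBondConfig ω) (startCorner hE) n = turnCount (E.bcBondConfig ω') (startCorner hE) n' := by
  -- the edge set of `Ω_δ` is finite (inlined, as in `S5.turnCount_touch`)
  have hfin : (discreteDomainGraph E.Ω E.δ).edgeSet.Finite := by
    have hV : (meshDomain E.Ω E.δ).Finite := meshDomain_finite hE.isBounded hE.delta_pos
    refine ((hV.prod hV).image (fun q : Site 2 × Site 2 => s(q.1, q.2))).subset fun e he => ?_
    induction e using Sym2.ind with
    | _ a b =>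
      have hab := discreteDomainGraph_adj_iff.1 ((SimpleGraph.mem_edgeSet _).1 he)
      exact ⟨(a, b), ⟨hab.2.1, hab.2.2⟩, rfl⟩
  -- close the edges of `Ω_δ` not in `ω'`, resp. not in `ω`
  obtain ⟨m, hm, hcm, htc⟩ := visit_chain hE hH hA hn hcn (hfin.sdiff (t := ω'))
  obtain ⟨m', hm', hcm', htc'⟩ := visit_chain hE hH hA hn' hcn' (hfin.sdiff (t := ω))
  rw [← htc, ← htc']
  refine S5.turnCount_eq_of_agree_off hE hH (e := cTgt c) (fun e' _ => ?_) hm hm' hcm hcm'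
  simp only [DiscreteDobrushin.mem_bcBondConfig_iff, Set.mem_sdiff]
  tauto

/-- **Wired TouchPhase, with a reference configuration**: if some exploration visits `c` (vertex on `A`)
with turn count `τ`, every exploration visiting `c` has turn count `τ` there.
[cite: Smirnov2010, proof of Lemma 4.5] -/
theorem turnCount_visit_const (hH : HoleFree {f : Site 2 | E.IsInnerFace f}) {c : Site 2 × Fin 4}
    (hA : c.1 ∈ E.zdArcA) {ω₀ : BondConfig (Site 2)} {n₀ : ℕ} {τ : ℤ} (hn₀ : n₀ < exitTime hE ω₀)
    (hcn₀ : cornerOrbit (E.bcBondConfig ω₀) (startCorner hE) n₀ = c)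
    (hτ : turnCount (E.bcBondConfig ω₀) (startCorner hE) n₀ = τ) (ω : BondConfig (Site 2)) (n : ℕ)
    (hn : n < exitTime hE ω) (hcn : cornerOrbit (E.bcBondConfig ω) (startCorner hE) n = c) :
    turnCount (E.bcBondConfig ω) (startCorner hE) n = τ :=
  (turnCount_visit hE hH hA hn hn₀ hcn hcn₀).trans hτ

end Visit

/-! ## Forced predecessors and the evaluation of a corner observable -/

/-- **The predecessor of a dart through an open source edge.** If `orb j = (v, k)` is not the start corner
and its source edge `s(v, v + u_k)` is open, then `j = j' + 1` and `orb j' = (v + u_k, k + 1)` (the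
follow-predecessor; the cross-predecessor `(v, k + 3)` would arrive across the same edge, closed).
[cite: Smirnov2001, §2] -/
theorem orbit_pred_of_mem (hE : E.IsZdAdmissible) {v : Site 2} {k : Fin 4} (hne : (v, k) ≠ startCorner hE)
    (hopen : cSrc (v, k) ∈ E.bcBondConfig ω) {j : ℕ}
    (h : cornerOrbit (E.bcBondConfig ω) (startCorner hE) j = (v, k)) :
    ∃ j', j = j' + 1 ∧ cornerOrbit (E.bcBondConfig ω) (startCorner hE) j' = (v + cornerUnit k, k + 1) := by
  rcases j with _ | j'
  · exact absurd h.symm hne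
  · refine ⟨j', rfl, ?_⟩
    rw [cornerOrbit_succ] at h
    have htgt : cTgt (v + cornerUnit k, k + 1) = cSrc (v, k) := by
      rw [cTgt, cSrc]
      simp only
      rw [fin4_add_one_add_one, cornerUnit_add_two, ← sub_eq_add_neg, add_sub_cancel_right, Sym2.eq_swap]
    have hnext : nextCorner (E.bcBondConfig ω) (v + cornerUnit k, k + 1) = (v, k) := by
      rw [nextCorner_of_mem (show cTgt (v + cornerUnit k, k + 1) ∈ E.bcBondConfig ω by rw [htgt]; exact hopen)]
      simp only
      rw [fin4_add_one_add_one, cornerUnit_add_two, fin4_add_one_add_three]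
      ext <;> simp
    exact nextCorner_injective (h.trans hnext.symm)

/-- **The visit event of a dart is measurable** (it is read off the completed configuration). [folklore] -/
theorem measurableSet_visit (hE : E.IsZdAdmissible) (c : Site 2 × Fin 4) :
    MeasurableSet {ω : BondConfig (Site 2) | ∃ n < exitTime hE ω, cornerOrbit (E.bcBondConfig ω) (startCorner hE) n = c} :=
  S5.measurableSet_of_bcBondConfig hE fun ω ω' h => by rw [S5.exitTime_congr hE h, h]

/-- **Evaluation of a corner observable on a forced visit.** If the coded corner `r` (vertex `v`, face `f`)
is visited by an exploration iff the reference corner `(w, 0)` is, and the turn count at every visit of `r`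
is the constant `τ`, then `cornerObs E E.δ v f = sixthPhase τ · P((w, 0) is visited)`: pathwise the corner
integrand is the dart weight of `r` (`S5.cornerObs_eq_of_dartW`), `sixthPhase τ` on the event (one visit,
darts of a cut orbit being distinct) and `0` off it. [cite: DuminilCopin2012Parafermion, Proposition 5] -/
theorem cornerObs_eq_of_visit_iff (hE : E.IsZdAdmissible) {r : Site 2 × Fin 4} {v f : Site 2} (h1 : r.1 = v)
    (h2 : cFace r = f) (w : Site 2) (τ : ℤ)
    (hiff : ∀ ω : BondConfig (Site 2),
      (∃ j < exitTime hE ω, cornerOrbit (E.bcBondConfig ω) (startCorner hE) j = r) ↔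
        ∃ n < exitTime hE ω, cornerOrbit (E.bcBondConfig ω) (startCorner hE) n = (w, 0))
    (hτ : ∀ (ω : BondConfig (Site 2)) (j : ℕ), j < exitTime hE ω →
      cornerOrbit (E.bcBondConfig ω) (startCorner hE) j = r → turnCount (E.bcBondConfig ω) (startCorner hE) j = τ) :
    cornerObs E E.δ v f = sixthPhase τ * (((bondPercolation (zdGraph 2) half).real
      {ω : BondConfig (Site 2) | ∃ n < exitTime hE ω, cornerOrbit (E.bcBondConfig ω) (startCorner hE) n = (w, 0)} : ℝ) : ℂ) := by
  refine S5.cornerObs_eq_of_dartW hE h1 h2 w _ fun ω => ?_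
  by_cases ht : ω ∈ {ω : BondConfig (Site 2) | ∃ n < exitTime hE ω,
      cornerOrbit (E.bcBondConfig ω) (startCorner hE) n = (w, 0)}
  · rw [Set.indicator_of_mem ht]
    obtain ⟨j, hj, hjr⟩ := (hiff ω).2 ht
    rw [dartW_eq_single hj fun j' hj' => ⟨fun h => S5.orbit_inj hE (fun k hk => isInnerFace_of_lt_exitTime hE ω hk)
      hj' hj (h.trans hjr.symm), fun h => h ▸ hjr⟩, hτ ω j hj hjr]
  · rw [Set.indicator_of_notMem ht]
    exact dartW_eq_zero fun j hj hjr => ht ((hiff ω).1 ⟨j, hj, hjr⟩)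

end WiredTouch

/-- **Registered one-line form `stub_anchor_wiredPhase`** of `WiredTouch.turnCount_visit` (wired TouchPhase;
generic helper of the wired-side phase packages of stub `stub_anchorMoment_of_IP`): the winding of the
exploration at a dart whose vertex lies on the wired arc is configuration-independent.
[cite: Smirnov2010, proof of Lemma 4.5] -/
theorem stub_anchor_wiredPhase : ∀ (E : DiscreteDobrushin) (hE : E.IsZdAdmissible) (ω ω' : BondConfig (Site 2)) (c : Site 2 × Fin 4) (n n' : ℕ), HoleFree {f : Site 2 | E.IsInnerFace f} → c.1 ∈ E.zdArcA → n < exitTime hE ω → n' < exitTime hE ω' → cornerOrbit (E.bcBondConfig ω) (startCorner hE) n = c → cornerOrbit (E.bcBondConfig ω') (startCorner hE) n' = c → turnCount (E.bcBondConfig ω) (startCorner hE) n = turnCount (E.bcBondConfig ω') (startCorner hE) n' :=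
  fun _ hE _ _ _ _ _ hH hA hn hn' hcn hcn' => WiredTouch.turnCount_visit hE hH hA hn hn' hcn hcn'

end Summit.CriticalPhenomena.CardyFormulaZ2.Theorems.ParafermionFamiliesToSLESix.StripAnchored

end
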